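import Summits.QuantumFields.YangMills.Theorems.UnitScaleTiltProp7PinnedCovBiharmonicUniqueness
import HarnessLib

/-!
# Route `UnitScaleTilt`, crux K1 «MinimiserStabilityRegPr» (stmt-QuantumFields-19200), route-R E′ path (α′), scheme (E1) ∕ P-cov1 at the CURVED background — (I-site-cov):
# EXISTENCE OF THE PINNED `Δ_U`-BIHARMONIC SOLUTIONS — for every source `g` there is a pinned `χ` (`χ|_C = 0`) with `Δ_U(Δ_Uχ) = g` OFF `C`; hence the pinned
# `Δ_W`-biharmonic INTERPOLANT `φ_H` of P-cov1 ✓p655977 EXISTS, and so do the monopole∕dipole fields `w` of ✓`Prop7CovInterpKernelDual`'s kernel rows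

Cell `ym3-torus`, extra width seat `ym-routeR-w6` (gen 6).  THEOREMS ONLY (0 `def`, 0 `sorry`); `--supports stmt-QuantumFields-19200`, count-neutral.  YM₃ on T³ is a ladder rung (R3),
not the Clay problem; nothing here claims a stub, the crux, d = 4 or the mass gap.

WHY ∕ HOW.  On the finite-dimensional `ℂ`-space of matrix site fields, the PINNED fields `V₀ = {χ : χ|_C = 0}` form a submodule and `L := P_off ∘ Δ_U²` (restriction of the
covariant bi-Laplacian to the non-centre sites) maps `V₀` to itself `ℂ`-linearly (✓ `B9Eq39Adjoint.covD_add∕covD_smul`).  `L` is INJECTIVE by ✓p668541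
`eq_zero_of_pinned_covBilaplace_off` (exact, any unitary background, nonempty homogeneous pins), hence SURJECTIVE (`LinearMap.injective_iff_surjective`): every off-centre
source is attained.  No Fourier analysis (the flat (E) ✓p657675 used it), no (D1), no frames, no `e`-smallness.

WHAT IS PROVED (ns `…Theorems.Prop7PinnedCovBiharmonicSolve`; torus `Site P j`, `T = torusT P j`, unitary `U`, `Δ_Uf = divB T U (fun μ => covD T U μ f)`).
* §1 `covLaplace_add'`, `covLaplace_smul'`, `covBilaplace_add`, `covBilaplace_smul` (linearity, any units `U`).
* §2 ★★★ `exists_pinned_covBilaplace_eq_off` — nonempty homogeneous finset of pins `C`, unitary `U`: `∀ g, ∃ χ, χ|_C = 0 ∧ ∀ z ∉ C, Δ_U²χ z = g z`.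
* §3 ★★★ `exists_covInterpolant` (`∀ φ, ∃ φ_H, φ_H|_C = φ|_C ∧ Δ_U²φ_H = 0 off C`) and the T³ readings ★★★ `exists_pinned_covBilaplace_eq_off_T3`, ★★★ `exists_covInterpolant_T3`
  (`C = ι_k(T^{(k)})`, `SU(2)` background `W` in p483802's letters — P-cov1's `φ_H` and (E1)'s `LinCorr` EXIST at the curved `W`; uniqueness ✓p668541 `covInterpolant_unique_T3`).
HONEST SCOPE.  Qualitative existence (finite-dimensional linear algebra); every SIZE row ((hK₀)(hK)(hK₂), P-cov2) is elsewhere.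

References: T. Bałaban, CMP 99 (1985) 75–102 [Balaban1985RegularSpaces] ((1.14) p.78); CMP 95 (1984) 17–40 [Balaban1984PropagatorsI] ((1.21) p.21); CMP 102 (1985) 277–309
[Balaban1985Variational] (Prop. 7 p.299).
-/

set_option autoImplicit false

noncomputable section

open scoped BigOperators Matrix.Norms.L2Operator Matrix

namespace Summit.QuantumFields.YangMills.Theorems.Prop7PinnedCovBiharmonicSolve

open Literature.MathematicalPhysics.QuantumFieldTheory.Balaban1983to89
open B9Eq39Adjoint (R covD covDstar divB)
open B9TorusCalculus (torusT)
open Summit.QuantumFields.YangMills.Theorems.Prop7PinnedCovBiharmonicUniqueness (eq_zero_of_pinned_covBilaplace_off)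

variable {P : Params} {j : ℕ} {N : ℕ}

/-! ## §1 Linearity of `Δ_U` and `Δ_U²` (any units) -/

section Linear

variable (U : Fin P.d → Site P j → (Matrix (Fin N) (Fin N) ℂ)ˣ)

/-- `Δ_U(f + g) = Δ_Uf + Δ_Ug`. [cite: Balaban1985BackgroundPropagators, (3.8) p.392] -/
theorem covLaplace_add' (f g : Site P j → Matrix (Fin N) (Fin N) ℂ) (x : Site P j) :
    divB (torusT P j) U (fun μ => covD (torusT P j) U μ (f + g)) x
      = divB (torusT P j) U (fun μ => covD (torusT P j) U μ f) x + divB (torusT P j) U (fun μ => covD (torusT P j) U μ g) x := by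
  have hD : ∀ (μ : Fin P.d) (y : Site P j), covD (torusT P j) U μ (f + g) y = covD (torusT P j) U μ f y + covD (torusT P j) U μ g y :=
    fun μ y => B9Eq39Adjoint.covD_add (torusT P j) U μ f g y
  simp only [divB, covDstar, hD, B9Eq39Adjoint.R_add, ← Finset.sum_add_distrib]
  refine Finset.sum_congr rfl fun μ _ => ?_
  abel

/-- `Δ_U(c•f) = c•Δ_Uf` (`c ∈ ℂ`). [cite: Balaban1985BackgroundPropagators, (3.8) p.392] -/
theorem covLaplace_smul' (c : ℂ) (f : Site P j → Matrix (Fin N) (Fin N) ℂ) (x : Site P j) :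
    divB (torusT P j) U (fun μ => covD (torusT P j) U μ (c • f)) x = c • divB (torusT P j) U (fun μ => covD (torusT P j) U μ f) x := by
  have hD : ∀ (μ : Fin P.d) (y : Site P j), covD (torusT P j) U μ (c • f) y = c • covD (torusT P j) U μ f y :=
    fun μ y => B9Eq39Adjoint.covD_smul (torusT P j) U c μ f y
  simp only [divB, covDstar, hD, B9Eq39Adjoint.R_smul, Finset.smul_sum, smul_sub]

/-- `Δ_U²` is additive. [cite: Balaban1985BackgroundPropagators, (3.8) p.392] -/
theorem covBilaplace_add (f g : Site P j → Matrix (Fin N) (Fin N) ℂ) (x : Site P j) :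
    divB (torusT P j) U (fun μ => covD (torusT P j) U μ (fun y => divB (torusT P j) U (fun ν => covD (torusT P j) U ν (f + g)) y)) x
      = divB (torusT P j) U (fun μ => covD (torusT P j) U μ (fun y => divB (torusT P j) U (fun ν => covD (torusT P j) U ν f) y)) x
        + divB (torusT P j) U (fun μ => covD (torusT P j) U μ (fun y => divB (torusT P j) U (fun ν => covD (torusT P j) U ν g) y)) x := by
  have e : (fun y => divB (torusT P j) U (fun ν => covD (torusT P j) U ν (f + g)) y)
      = (fun y => divB (torusT P j) U (fun ν => covD (torusT P j) U ν f) y) + (fun y => divB (torusT P j) U (fun ν => covD (torusT P j) U ν g) y) := by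
    funext y; exact covLaplace_add' U f g y
  rw [e, covLaplace_add']

/-- `Δ_U²` is `ℂ`-homogeneous. [cite: Balaban1985BackgroundPropagators, (3.8) p.392] -/
theorem covBilaplace_smul (c : ℂ) (f : Site P j → Matrix (Fin N) (Fin N) ℂ) (x : Site P j) :
    divB (torusT P j) U (fun μ => covD (torusT P j) U μ (fun y => divB (torusT P j) U (fun ν => covD (torusT P j) U ν (c • f)) y)) x
      = c • divB (torusT P j) U (fun μ => covD (torusT P j) U μ (fun y => divB (torusT P j) U (fun ν => covD (torusT P j) U ν f) y)) x := by
  have e : (fun y => divB (torusT P j) U (fun ν => covD (torusT P j) U ν (c • f)) y)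
      = c • (fun y => divB (torusT P j) U (fun ν => covD (torusT P j) U ν f) y) := by
    funext y; exact covLaplace_smul' U c f y
  rw [e, covLaplace_smul']

end Linear

/-! ## §2 ★★★ Existence: every off-centre source is the covariant bi-Laplacian of a pinned field -/

/-- ★★★ **EXISTENCE OF PINNED `Δ_U`-BIHARMONIC SOLUTIONS**: nonempty homogeneous finset of pins `C` on the torus, unitary background; for every matrix site field `g` there is
`χ` with `χ|_C = 0` and `Δ_U(Δ_Uχ)(z) = g(z)` for all `z ∉ C` (injective ⇒ surjective on the finite-dimensional pinned space; injectivity = ✓p668541).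
[cite: Balaban1985RegularSpaces, (1.14) p.78; Balaban1984PropagatorsI, (1.21) p.21] -/
theorem exists_pinned_covBilaplace_eq_off [NeZero N] {U : Fin P.d → Site P j → (Matrix (Fin N) (Fin N) ℂ)ˣ}
    (hU : ∀ ν x, (U ν x : Matrix (Fin N) (Fin N) ℂ) ∈ unitary (Matrix (Fin N) (Fin N) ℂ))
    (C : Finset (Site P j)) (hC : C.Nonempty)
    (htrans : ∀ c ∈ C, ∀ c' ∈ C, ∃ a : Site P j, (∀ x : Site P j, x ∈ C ↔ x + a ∈ C) ∧ c + a = c')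
    (g : Site P j → Matrix (Fin N) (Fin N) ℂ) :
    ∃ χ : Site P j → Matrix (Fin N) (Fin N) ℂ, (∀ y ∈ C, χ y = 0) ∧
      ∀ z ∉ C, divB (torusT P j) U (fun μ => covD (torusT P j) U μ
        (fun y => divB (torusT P j) U (fun ν => covD (torusT P j) U ν χ) y)) z = g z := by
  classical
  -- the pinned subspace
  let V₀ : Submodule ℂ (Site P j → Matrix (Fin N) (Fin N) ℂ) :=
    { carrier := {χ | ∀ y ∈ C, χ y = 0}
      add_mem' := fun {a b} ha hb y hy => by simp [Pi.add_apply, ha y hy, hb y hy]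
      zero_mem' := fun y _ => rfl
      smul_mem' := fun c {a} ha y hy => by simp [Pi.smul_apply, ha y hy] }
  -- the operator `P_off ∘ Δ_U²` as an endomorphism of `V₀`
  let Lfun : (Site P j → Matrix (Fin N) (Fin N) ℂ) → (Site P j → Matrix (Fin N) (Fin N) ℂ) := fun χ z =>
    if z ∈ C then 0 else divB (torusT P j) U (fun μ => covD (torusT P j) U μ
      (fun y => divB (torusT P j) U (fun ν => covD (torusT P j) U ν χ) y)) z
  have hLmem : ∀ χ : Site P j → Matrix (Fin N) (Fin N) ℂ, Lfun χ ∈ V₀ := fun χ y hy => by simp [Lfun, hy]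
  have hLadd : ∀ a b : Site P j → Matrix (Fin N) (Fin N) ℂ, Lfun (a + b) = Lfun a + Lfun b := by
    intro a b; funext z
    by_cases hz : z ∈ C
    · simp [Lfun, hz]
    · simp only [Lfun, Pi.add_apply, if_neg hz]
      exact covBilaplace_add U a b z
  have hLsmul : ∀ (c : ℂ) (a : Site P j → Matrix (Fin N) (Fin N) ℂ), Lfun (c • a) = c • Lfun a := by
    intro c a; funext z
    by_cases hz : z ∈ C
    · simp [Lfun, hz]
    · simp only [Lfun, Pi.smul_apply, if_neg hz]
      exact covBilaplace_smul U c a z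
  let L : V₀ →ₗ[ℂ] V₀ :=
    { toFun := fun χ => ⟨Lfun χ, hLmem χ⟩
      map_add' := fun a b => by ext1; simp [hLadd]
      map_smul' := fun c a => by ext1; simp [hLsmul] }
  -- injective by the uniqueness theorem
  have hinj : Function.Injective L := by
    intro a b hab
    have hdiff : L (a - b) = 0 := by rw [map_sub, hab, sub_self]
    have hval : Lfun (a - b : V₀) = 0 := congrArg Subtype.val hdiff
    have hzero : ((a - b : V₀) : Site P j → Matrix (Fin N) (Fin N) ℂ) = 0 := by
      refine eq_zero_of_pinned_covBilaplace_off hU C hC htrans _ (a - b).2 fun z hz => ?_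
      have h := congrFun hval z
      simp only [Lfun, if_neg hz, Pi.zero_apply] at h
      exact h
    have : a - b = 0 := Subtype.ext hzero
    exact sub_eq_zero.1 this
  have hsurj : Function.Surjective L := LinearMap.injective_iff_surjective.1 hinj
  -- the target: `g` off `C`, `0` on `C`
  let t : V₀ := ⟨fun z => if z ∈ C then 0 else g z, fun y hy => by simp [hy]⟩
  obtain ⟨χ, hχ⟩ := hsurj t
  refine ⟨(χ : Site P j → Matrix (Fin N) (Fin N) ℂ), χ.2, fun z hz => ?_⟩
  have h := congrFun (congrArg Subtype.val hχ) z
  simp only [L, t, Lfun, LinearMap.coe_mk, AddHom.coe_mk, if_neg hz] at h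
  exact h

/-! ## §3 ★★★ The pinned covariant biharmonic interpolant exists; the T³ readings -/

/-- ★★★ **THE PINNED `Δ_U`-BIHARMONIC INTERPOLANT EXISTS**: for every `φ` there is `φ_H` agreeing with `φ` on `C` and with `Δ_U(Δ_Uφ_H) = 0` off `C`
(`φ_H := φ − χ`, `χ` pinned with `Δ_U²χ = Δ_U²φ` off `C`). [cite: Balaban1985RegularSpaces, (1.14) p.78; Balaban1985Variational, Prop. 7 p.299] -/
theorem exists_covInterpolant [NeZero N] {U : Fin P.d → Site P j → (Matrix (Fin N) (Fin N) ℂ)ˣ}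
    (hU : ∀ ν x, (U ν x : Matrix (Fin N) (Fin N) ℂ) ∈ unitary (Matrix (Fin N) (Fin N) ℂ))
    (C : Finset (Site P j)) (hC : C.Nonempty)
    (htrans : ∀ c ∈ C, ∀ c' ∈ C, ∃ a : Site P j, (∀ x : Site P j, x ∈ C ↔ x + a ∈ C) ∧ c + a = c')
    (φ : Site P j → Matrix (Fin N) (Fin N) ℂ) :
    ∃ φH : Site P j → Matrix (Fin N) (Fin N) ℂ, (∀ y ∈ C, φH y = φ y) ∧
      ∀ z ∉ C, divB (torusT P j) U (fun μ => covD (torusT P j) U μ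
        (fun y => divB (torusT P j) U (fun ν => covD (torusT P j) U ν φH) y)) z = 0 := by
  obtain ⟨χ, hχ0, hχ⟩ := exists_pinned_covBilaplace_eq_off hU C hC htrans
    (fun z => divB (torusT P j) U (fun μ => covD (torusT P j) U μ (fun y => divB (torusT P j) U (fun ν => covD (torusT P j) U ν φ) y)) z)
  refine ⟨φ + (-1 : ℂ) • χ, fun y hy => by simp [hχ0 y hy], fun z hz => ?_⟩
  rw [covBilaplace_add, covBilaplace_smul, hχ z hz]
  simp

section T3

open Literature.MathematicalPhysics.QuantumFieldTheory.Balaban1983to89.T3ContinuumYM3Torus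
open B10Eq27TorusAxialLog (unitsField toUField)
open B15DeterminingSets (embIter)
open Summit.QuantumFields.YangMills.Theorems.Prop7CovHodgeSplit (unitsField_toUField_mem_unitary)
open Summit.QuantumFields.YangMills.Theorems.Prop7PinnedHarmonicMass (centres_homogeneous)

/-- ★★★ **T³ READING**: run `K` of a T³ family, ANY `SU(2)` background `W`, any `k`: every matrix source is, off the `k`-centres, the covariant bi-Laplacian of a field
vanishing on the `k`-centres. [cite: Balaban1985RegularSpaces, (1.14) p.78] -/
theorem exists_pinned_covBilaplace_eq_off_T3 (F : T3Family) (K k : ℕ)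
    (W : GaugeField (F.P K) 0 (Matrix.specialUnitaryGroup (Fin 2) ℂ)) (g : Site (F.P K) 0 → Matrix (Fin 2) (Fin 2) ℂ) :
    ∃ χ : Site (F.P K) 0 → Matrix (Fin 2) (Fin 2) ℂ, (∀ y : Site (F.P K) k, χ (embIter k y) = 0) ∧
      ∀ x : Site (F.P K) 0, x ∉ Set.range (embIter k) →
        divB (torusT (F.P K) 0) (fun κ z => unitsField (toUField W) ⟨z, κ⟩)
          (fun μ => covD (torusT (F.P K) 0) (fun κ z => unitsField (toUField W) ⟨z, κ⟩) μ
            (fun y => divB (torusT (F.P K) 0) (fun κ z => unitsField (toUField W) ⟨z, κ⟩)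
              (fun ν => covD (torusT (F.P K) 0) (fun κ z => unitsField (toUField W) ⟨z, κ⟩) ν χ) y)) x = g x := by
  classical
  set C : Finset (Site (F.P K) 0) := (Finset.univ : Finset (Site (F.P K) k)).image (embIter k) with hCdef
  have hCne : C.Nonempty := ⟨embIter k default, Finset.mem_image_of_mem _ (Finset.mem_univ _)⟩
  have hU := fun κ (z : Site (F.P K) 0) => unitsField_toUField_mem_unitary W κ z
  obtain ⟨χ, h0, hχ⟩ := exists_pinned_covBilaplace_eq_off (U := fun κ z => unitsField (toUField W) ⟨z, κ⟩) hU C hCne (centres_homogeneous k) g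
  refine ⟨χ, fun y => h0 _ (by rw [hCdef, Finset.mem_image]; exact ⟨y, Finset.mem_univ _, rfl⟩), fun x hx => hχ x ?_⟩
  intro hxC
  rw [hCdef, Finset.mem_image] at hxC
  obtain ⟨y, _, hy⟩ := hxC
  exact hx ⟨y, hy⟩

/-- ★★★ **T³ READING — P-cov1's `φ_H` EXISTS AT THE CURVED BACKGROUND**: for every matrix site field `φ` on the finest torus there is `φ_H` equal to `φ` on the `k`-centres with
`Δ_W(Δ_Wφ_H) = 0` off them (ANY `SU(2)` background; unique by ✓ `Prop7PinnedCovBiharmonicUniqueness.covInterpolant_unique_T3`).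
[cite: Balaban1985RegularSpaces, (1.14) p.78; Balaban1985Variational, Prop. 7 p.299] -/
theorem exists_covInterpolant_T3 (F : T3Family) (K k : ℕ)
    (W : GaugeField (F.P K) 0 (Matrix.specialUnitaryGroup (Fin 2) ℂ)) (φ : Site (F.P K) 0 → Matrix (Fin 2) (Fin 2) ℂ) :
    ∃ φH : Site (F.P K) 0 → Matrix (Fin 2) (Fin 2) ℂ, (∀ y : Site (F.P K) k, φH (embIter k y) = φ (embIter k y)) ∧
      ∀ x : Site (F.P K) 0, x ∉ Set.range (embIter k) →
        divB (torusT (F.P K) 0) (fun κ z => unitsField (toUField W) ⟨z, κ⟩)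
          (fun μ => covD (torusT (F.P K) 0) (fun κ z => unitsField (toUField W) ⟨z, κ⟩) μ
            (fun y => divB (torusT (F.P K) 0) (fun κ z => unitsField (toUField W) ⟨z, κ⟩)
              (fun ν => covD (torusT (F.P K) 0) (fun κ z => unitsField (toUField W) ⟨z, κ⟩) ν φH) y)) x = 0 := by
  classical
  set C : Finset (Site (F.P K) 0) := (Finset.univ : Finset (Site (F.P K) k)).image (embIter k) with hCdef
  have hCne : C.Nonempty := ⟨embIter k default, Finset.mem_image_of_mem _ (Finset.mem_univ _)⟩
  have hU := fun κ (z : Site (F.P K) 0) => unitsField_toUField_mem_unitary W κ z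
  obtain ⟨φH, hH, hEL⟩ := exists_covInterpolant (U := fun κ z => unitsField (toUField W) ⟨z, κ⟩) hU C hCne (centres_homogeneous k) φ
  refine ⟨φH, fun y => hH _ (by rw [hCdef, Finset.mem_image]; exact ⟨y, Finset.mem_univ _, rfl⟩), fun x hx => hEL x ?_⟩
  intro hxC
  rw [hCdef, Finset.mem_image] at hxC
  obtain ⟨y, _, hy⟩ := hxC
  exact hx ⟨y, hy⟩

end T3

end Summit.QuantumFields.YangMills.Theorems.Prop7PinnedCovBiharmonicSolve

end
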